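import Summits.BirchSwinnertonDyer.Rank1Residual.X11b.TwistTransportRam
import Literature.NumberTheory.EllipticCurves.PastenValuationProductThm115Proofs
import Literature.NumberTheory.EllipticCurves.TamagawaVariableChangeProofs
import Literature.NumberTheory.EllipticCurves.TamagawaNeZeroProofs
import Literature.NumberTheory.EllipticCurves.TamagawaProofs
import HarnessLib

/-!
# Class X11b, route p2: the `p`-part of the Tamagawa product is unchanged by the twist by the Heegner field (cell `b2b-bsdres`, sub-cell `multr1-p2`)

HONEST FRAMING (cell `b2b-bsdres`, run/shared/lean/b2b/bsd-rank1-residual/, verbatim in every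
file): the goal of the cell is to DELETE the COMBINATION-SHAPED residual classes of the
Birch–Swinnerton-Dyer formula for ALL analytic-rank `≤ 1` elliptic curves over `ℚ` — "full BSD
formula for every rank `≤ 1` curve in class `C`" assembled STRICTLY from published theorems — so
that the rank-`≤ 1` remainder becomes exactly the CONSTRUCTION-SHAPED classes, which are TYPED
(missing-input `Prop`s), NOT attempted. This is not "finishing BSD". Sub-cell `multr1-p2` is a
RESEARCH ROUTE on class X11b; no claim beyond the stated class and locus.

THEOREMS ONLY (tree plumbing; item (d) of the transport list of HOME/b2b-bsdres-multr1-p2/REPORT.md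
§5 — the binder `hTam` of `X11b/BDPRouteTarget.lean`). Let `E/ℚ` (model `W`) be elliptic, `K` an
imaginary quadratic field in which every prime of the conductor `N` splits, `Wd = Cd • W^{(d_K)}`
ANY model of the twist, and `p ≥ 5` a prime. Then `ord_p ∏_ℓ c_ℓ(Wd) = ord_p ∏_ℓ c_ℓ(W)`
(`padicValNat_tamagawaProduct_twist_of_heegner`; [JetchevSkinnerWan2017, (7.4.b)/(eq:tamK)]).
Prime by prime (`padicValNat_localTamagawaNumber_twist_eq`): at `ℓ ∣ N`, `d_K ∈ (ℚ_ℓ^×)²`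
(`isSquare_discr_padic_of_heegner`), so `Wd ⊗ ℚ_ℓ ≅ W ⊗ ℚ_ℓ` and `c_ℓ(Wd) = c_ℓ(W)` (`c_ℓ` is an
isomorphism invariant, Silverman *AEC* VII.6 Ex. 7.6, tree `localTamagawaNumber_variableChange_holds`);
at `ℓ ∤ N`, `E` has good reduction, `c_ℓ(W) = 1`, and `Wd` is NOT multiplicative at `ℓ` — the
`j`-invariant is `ℓ`-integral at good reduction and has a pole at multiplicative reduction
(Silverman *AEC* VII.5 Prop. 5.1; `valuation_j_le_one_of_hasGoodReduction`,
`one_lt_valuation_j_of_hasMultiplicativeReduction`), while `j(Wd) = j(W)` — so Kodaira–Néron gives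
`c_ℓ(Wd) ≤ 4 < p` (Silverman *ATAEC* IV.9.2(d), tree `localTamagawaNumber_padic_le_four`). The
Tamagawa product is the finite product of the `c_ℓ` over the bad places of either curve
(`tamagawaProduct_eq_prod`).

References: [SilvermanAEC2009] VII.1 Prop. 1.3(b), VII.5 Prop. 5.1, VII.6 Ex. 7.6, X.5 Cor. 5.4;
[SilvermanATAEC1994] Cor. IV.9.2(d); [JetchevSkinnerWan2017] §7.4.
-/

noncomputable section

open scoped Classical

open WeierstrassCurve NumberField Literature.NumberTheory.EllipticCurves Rat.HeightOneSpectrum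

namespace Summit.BirchSwinnertonDyer.Rank1Residual.X11b

section Local

variable {R : Type*} [CommRing R] [IsDomain R] [IsDiscreteValuationRing R] {F : Type*} [Field F]
  [Algebra R F] [IsFractionRing R F]

/-- **The `j`-invariant is integral at a prime of good reduction**: for a minimal Weierstrass
equation with good reduction over the fraction field of a DVR, `v(j) ≥ 0` (multiplicatively:
`v(j) ≤ 1`), since `j = c₄³/Δ` with `c₄` integral and `Δ` a unit (Silverman, *AEC* VII.5
Prop. 5.1(a)). [cite: SilvermanAEC2009, VII.5 Prop. 5.1] -/
theorem valuation_j_le_one_of_hasGoodReduction (Z : WeierstrassCurve F) [Z.IsElliptic]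
    [hZ : Z.HasGoodReduction R] :
    (IsDiscreteValuationRing.maximalIdeal R).valuation F Z.j ≤ 1 := by
  have hΔ : (IsDiscreteValuationRing.maximalIdeal R).valuation F Z.Δ = 1 := hZ.goodReduction
  have hc : (IsDiscreteValuationRing.maximalIdeal R).valuation F Z.c₄ ≤ 1 := by
    rw [← integralModel_c₄_eq R Z]
    exact IsDedekindDomain.HeightOneSpectrum.valuation_le_one _ _
  have hj : Z.j = (Z.Δ)⁻¹ * Z.c₄ ^ 3 := by rw [j, Units.val_inv_eq_inv_val, coe_Δ']
  rw [hj, map_mul, map_inv₀, map_pow, hΔ, inv_one, one_mul]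
  exact pow_le_one₀ zero_le hc

/-- **The `j`-invariant has a pole at a prime of multiplicative reduction**: for a minimal
Weierstrass equation with multiplicative reduction over the fraction field of a DVR, `v(j) < 0`
(multiplicatively: `1 < v(j)`), since `j = c₄³/Δ` with `c₄` a unit and `v(Δ) > 0` (Silverman,
*AEC* VII.5 Prop. 5.1(b)). [cite: SilvermanAEC2009, VII.5 Prop. 5.1] -/
theorem one_lt_valuation_j_of_hasMultiplicativeReduction (Z : WeierstrassCurve F) [Z.IsElliptic]
    [hZ : Z.HasMultiplicativeReduction R] :
    1 < (IsDiscreteValuationRing.maximalIdeal R).valuation F Z.j := by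
  have hΔ : (IsDiscreteValuationRing.maximalIdeal R).valuation F Z.Δ < 1 := hZ.badReduction
  have hc : (IsDiscreteValuationRing.maximalIdeal R).valuation F Z.c₄ = 1 :=
    hZ.multiplicativeReduction
  have hΔ0 : 0 < (IsDiscreteValuationRing.maximalIdeal R).valuation F Z.Δ :=
    (Valuation.pos_iff _).mpr Z.isUnit_Δ.ne_zero
  have hj : Z.j = (Z.Δ)⁻¹ * Z.c₄ ^ 3 := by rw [j, Units.val_inv_eq_inv_val, coe_Δ']
  rw [hj, map_mul, map_inv₀, map_pow, hc, one_pow, mul_one]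
  exact (one_lt_inv₀ hΔ0).mpr hΔ

end Local

/-- Equal Weierstrass equations have equal `j` (whatever the `IsElliptic` witnesses). [folklore] -/
private theorem j_eq_of_eq {A : Type*} [CommRing A] {X Y : WeierstrassCurve A} [X.IsElliptic]
    [Y.IsElliptic] (h : X = Y) : X.j = Y.j := by
  subst h
  rfl

/-- The `j`-invariant of the `ℤ_ℓ`-minimal model of `X / ℚ_ℓ` is `j(X)` (Mathlib `variableChange_j`).
[folklore] -/
private theorem j_minimal {ℓ : ℕ} [Fact ℓ.Prime] (X : WeierstrassCurve ℚ_[ℓ]) [X.IsElliptic]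
    [(X.minimal ℤ_[ℓ]).IsElliptic] : (X.minimal ℤ_[ℓ]).j = X.j := by
  rw [j_eq_of_eq (X := X.minimal ℤ_[ℓ]) (Y := (X.exists_isMinimal ℤ_[ℓ]).choose • X) rfl,
    variableChange_j]

/-- **A curve with the `j`-invariant of a curve of good reduction at `ℓ` is not multiplicative at
`ℓ`** (in particular no model of a quadratic twist of a curve with good reduction at `ℓ` has
multiplicative reduction at `ℓ`): `j` is `ℓ`-integral for the one and would have a pole for the
other (Silverman, *AEC* VII.5 Prop. 5.1; `valuation_j_le_one_of_hasGoodReduction`,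
`one_lt_valuation_j_of_hasMultiplicativeReduction`). [cite: SilvermanAEC2009, VII.5 Prop. 5.1] -/
theorem not_hasMultiplicativeReductionAtPrime_of_j_eq {W Wd : WeierstrassCurve ℚ} [W.IsElliptic]
    [Wd.IsElliptic] (hj : Wd.j = W.j) (ℓ : ℕ) [Fact ℓ.Prime]
    (hgood : W.HasGoodReductionAtPrime ℓ) : ¬ Wd.HasMultiplicativeReductionAtPrime ℓ := by
  intro hm
  haveI : (W.baseChange ℚ_[ℓ]).IsElliptic :=
    inferInstanceAs (W.map (algebraMap ℚ ℚ_[ℓ])).IsElliptic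
  haveI : (Wd.baseChange ℚ_[ℓ]).IsElliptic :=
    inferInstanceAs (Wd.map (algebraMap ℚ ℚ_[ℓ])).IsElliptic
  haveI : ((W.baseChange ℚ_[ℓ]).minimal ℤ_[ℓ]).IsElliptic := by
    rw [WeierstrassCurve.minimal]; infer_instance
  haveI : ((Wd.baseChange ℚ_[ℓ]).minimal ℤ_[ℓ]).IsElliptic := by
    rw [WeierstrassCurve.minimal]; infer_instance
  haveI : ((W.baseChange ℚ_[ℓ]).minimal ℤ_[ℓ]).HasGoodReduction ℤ_[ℓ] := hgood
  haveI : ((Wd.baseChange ℚ_[ℓ]).minimal ℤ_[ℓ]).HasMultiplicativeReduction ℤ_[ℓ] := hm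
  have h1 := valuation_j_le_one_of_hasGoodReduction (R := ℤ_[ℓ]) ((W.baseChange ℚ_[ℓ]).minimal ℤ_[ℓ])
  have h2 := one_lt_valuation_j_of_hasMultiplicativeReduction (R := ℤ_[ℓ])
    ((Wd.baseChange ℚ_[ℓ]).minimal ℤ_[ℓ])
  have e1 : ((W.baseChange ℚ_[ℓ]).minimal ℤ_[ℓ]).j = algebraMap ℚ ℚ_[ℓ] W.j := by
    rw [j_minimal]; exact W.map_j (algebraMap ℚ ℚ_[ℓ])
  have e2 : ((Wd.baseChange ℚ_[ℓ]).minimal ℤ_[ℓ]).j = algebraMap ℚ ℚ_[ℓ] W.j := by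
    rw [j_minimal, ← hj]; exact Wd.map_j (algebraMap ℚ ℚ_[ℓ])
  rw [e1] at h1
  rw [e2] at h2
  exact absurd h1 (not_le.mpr h2)

/-- `ord_p` of a finite product of non-zero naturals is the sum of the `ord_p`. [folklore] -/
private theorem padicValNat_finset_prod (p : ℕ) [Fact p.Prime] {ι : Type*} (s : Finset ι)
    (f : ι → ℕ) (hf : ∀ i ∈ s, f i ≠ 0) :
    padicValNat p (∏ i ∈ s, f i) = ∑ i ∈ s, padicValNat p (f i) := by
  induction s using Finset.induction_on with
  | empty => simp
  | insert a s ha ih =>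
    rw [Finset.prod_insert ha, Finset.sum_insert ha,
      padicValNat.mul (hf a (Finset.mem_insert_self a s))
        (Finset.prod_ne_zero_iff.mpr fun i hi => hf i (Finset.mem_insert_of_mem hi)),
      ih fun i hi => hf i (Finset.mem_insert_of_mem hi)]

/-- **`ord_p c_ℓ(E^{d_K}) = ord_p c_ℓ(E)` at every prime `ℓ`, for `p ≥ 5` and `K` satisfying the
Heegner hypothesis.** `W/ℚ` elliptic, `K` imaginary quadratic with every prime of the conductor
`N` of `W` split, `Wd = Cd • W^{(d_K)}` any model of the twist, `p ≥ 5`, `ℓ` any prime. If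
`ℓ ∣ N` then `d_K` is a square in `ℚ_ℓ` (`isSquare_discr_padic_of_heegner`), `Wd ⊗ ℚ_ℓ ≅ W ⊗ ℚ_ℓ`
(`exists_variableChange_smul_eq_quadraticTwist_sq`) and `c_ℓ(Wd) = c_ℓ(W)`
(`localTamagawaNumber_variableChange_holds`, Silverman VII.6 Ex. 7.6). If `ℓ ∤ N` then `W` is good
at `ℓ` (`dvd_conductorNorm_iff_not_hasGoodReductionAtPrime`), `c_ℓ(W) = 1`
(`localTamagawaNumber_eq_one_of_hasGoodReduction_holds`), `Wd` is not multiplicative at `ℓ`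
(`not_hasMultiplicativeReductionAtPrime_of_j_eq`, `j(Wd) = j(W)` by `variableChange_j`,
`j_quadraticTwist`), so `0 < c_ℓ(Wd) ≤ 4 < p` (Kodaira–Néron, `localTamagawaNumber_padic_le_four`,
`localTamagawaNumber_padic_ne_zero_holds`). [cite: SilvermanATAEC1994, Cor. IV.9.2(d) (PDF p. 340)]
[cite: SilvermanAEC2009, VII.6 Ex. 7.6 and X.5 Cor. 5.4] -/
theorem padicValNat_localTamagawaNumber_twist_eq (W : WeierstrassCurve ℚ) [W.IsElliptic]
    (p : ℕ) [Fact p.Prime] (hp5 : 5 ≤ p) (K : Type) [Field K] [NumberField K]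
    (hK : IsImaginaryQuadratic K) (hH : SatisfiesHeegnerHypothesis (W.conductorNorm ℤ) K)
    {Wd : WeierstrassCurve ℚ} [Wd.IsElliptic] (Cd : VariableChange ℚ)
    (hWd : Cd • W.quadraticTwist (NumberField.discr K : ℚ) = Wd) (ℓ : ℕ) [Fact ℓ.Prime] :
    padicValNat p ((Wd.baseChange ℚ_[ℓ]).localTamagawaNumber ℤ_[ℓ]) =
      padicValNat p ((W.baseChange ℚ_[ℓ]).localTamagawaNumber ℤ_[ℓ]) := by
  have hp : p.Prime := Fact.out
  set d : ℚ := (NumberField.discr K : ℚ) with hd_def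
  have hD0 : d ≠ 0 := by rw [hd_def]; exact_mod_cast NumberField.discr_ne_zero K
  haveI : (W.baseChange ℚ_[ℓ]).IsElliptic :=
    inferInstanceAs (W.map (algebraMap ℚ ℚ_[ℓ])).IsElliptic
  haveI : (Wd.baseChange ℚ_[ℓ]).IsElliptic :=
    inferInstanceAs (Wd.map (algebraMap ℚ ℚ_[ℓ])).IsElliptic
  haveI : (W.quadraticTwist d).IsElliptic := W.isElliptic_quadraticTwist hD0
  by_cases hℓN : ℓ ∣ W.conductorNorm ℤ
  · -- `ℓ ∣ N`: `d_K` is a square in `ℚ_ℓ`, the two curves are `ℚ_ℓ`-isomorphic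
    obtain ⟨θ, hθ⟩ := isSquare_discr_padic_of_heegner K hK hH ℓ hℓN
    have hθ0 : θ ≠ 0 := by
      rintro rfl
      exact (map_ne_zero (algebraMap ℚ ℚ_[ℓ])).mpr hD0 (hθ.trans (mul_zero 0))
    obtain ⟨C, hC⟩ := (W.baseChange ℚ_[ℓ]).exists_variableChange_smul_eq_quadraticTwist_sq hθ0
    have h1 : (W.quadraticTwist d).baseChange ℚ_[ℓ] = C • W.baseChange ℚ_[ℓ] := by
      rw [hC, baseChange, baseChange, map_quadraticTwist, hθ, sq]
    have hYX : Wd.baseChange ℚ_[ℓ] = (Cd.map (algebraMap ℚ ℚ_[ℓ]) * C) • W.baseChange ℚ_[ℓ] := by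
      rw [← hWd, WeierstrassCurve.VariableChange.baseChange_smul_eq (W.quadraticTwist d) Cd ℚ_[ℓ],
        h1, mul_smul]
    rw [hYX, localTamagawaNumber_variableChange_holds ℤ_[ℓ] (W.baseChange ℚ_[ℓ])
      (Cd.map (algebraMap ℚ ℚ_[ℓ]) * C)]
  · -- `ℓ ∤ N`: `W` is good at `ℓ`, `Wd` is good or additive at `ℓ`
    have hgood : W.HasGoodReductionAtPrime ℓ := by
      by_contra h
      exact hℓN ((W.dvd_conductorNorm_iff_not_hasGoodReductionAtPrime ℓ).mpr h)
    have hcW : (W.baseChange ℚ_[ℓ]).localTamagawaNumber ℤ_[ℓ] = 1 := by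
      haveI : ((W.baseChange ℚ_[ℓ]).minimal ℤ_[ℓ]).HasGoodReduction ℤ_[ℓ] := hgood
      exact localTamagawaNumber_eq_one_of_hasGoodReduction_holds ℤ_[ℓ] _
    have hj : Wd.j = W.j := by
      rw [j_eq_of_eq hWd.symm, variableChange_j]
      exact W.j_quadraticTwist hD0
    have hns : ¬ ((Wd.baseChange ℚ_[ℓ]).minimal ℤ_[ℓ]).HasSplitMultiplicativeReduction ℤ_[ℓ] :=
      fun hs ↦ not_hasMultiplicativeReductionAtPrime_of_j_eq hj ℓ hgood
        hs.toHasMultiplicativeReduction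
    have h4 := localTamagawaNumber_padic_le_four ℓ (Wd.baseChange ℚ_[ℓ]) hns
    have hne := localTamagawaNumber_padic_ne_zero_holds ℓ (Wd.baseChange ℚ_[ℓ])
    rw [hcW, padicValNat_one_right, padicValNat.eq_zero_of_not_dvd]
    intro hdvd
    have := Nat.le_of_dvd (Nat.pos_of_ne_zero hne) hdvd
    omega

/-- **Transport (d): `ord_p ∏_ℓ c_ℓ(E^{d_K}) = ord_p ∏_ℓ c_ℓ(E)` for `p ≥ 5` under the Heegner
hypothesis** ([JetchevSkinnerWan2017, §7.4, (eq:tamK)]: "`c_ℓ(E^K) = c_ℓ(E)` for `ℓ ∣ N` split in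
`K`, and `p ∤ c_ℓ(E^K) ≤ 4` at the primes `ℓ ∣ d_K` of additive reduction"). For `W/ℚ` elliptic, `K`
imaginary quadratic with every prime of the conductor of `W` split, ANY model `Wd = Cd • W^{(d_K)}`
of the twist and any prime `p ≥ 5`: `padicValNat p Wd.tamagawaProduct = padicValNat p
W.tamagawaProduct`. Proof: write both Tamagawa products as finite products of the `p`-adic local
Tamagawa numbers over the union of the bad places of `W` and `Wd` (`tamagawaProduct_eq_prod`), all
factors non-zero (`localTamagawaNumber_padic_ne_zero_holds`), and compare prime by prime
(`padicValNat_localTamagawaNumber_twist_eq`). This DISCHARGES the binder `hTam` of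
`X11b/BDPRouteTarget.lean` (`bsdp_of_classX11b_of_locus_of_tamagawaTransport`).
[cite: JetchevSkinnerWan2017, §7.4.1 (pp. 29–31)] [cite: SilvermanATAEC1994, Cor. IV.9.2(d) (PDF p. 340)] -/
theorem padicValNat_tamagawaProduct_twist_of_heegner (W : WeierstrassCurve ℚ) [W.IsElliptic]
    (p : ℕ) [Fact p.Prime] (hp5 : 5 ≤ p) (K : Type) [Field K] [NumberField K]
    (hK : IsImaginaryQuadratic K) (hH : SatisfiesHeegnerHypothesis (W.conductorNorm ℤ) K)
    {Wd : WeierstrassCurve ℚ} [Wd.IsElliptic] (Cd : VariableChange ℚ)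
    (hWd : Cd • W.quadraticTwist (NumberField.discr K : ℚ) = Wd) :
    padicValNat p Wd.tamagawaProduct = padicValNat p W.tamagawaProduct := by
  -- the union of the bad places of `W` and `Wd`
  have hfW : (W.badPlaces ℤ).Finite := W.finite_badPlaces_holds ℤ
  have hfWd : (Wd.badPlaces ℤ).Finite := Wd.finite_badPlaces_holds ℤ
  set s : Finset (IsDedekindDomain.HeightOneSpectrum ℤ) := hfW.toFinset ∪ hfWd.toFinset with hs
  have hsW : ∀ v, ¬ W.HasGoodReductionAt v → v ∈ s := fun v hv ↦
    Finset.mem_union_left _ (by rw [Set.Finite.mem_toFinset, mem_badPlaces_iff]; exact hv)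
  have hsWd : ∀ v, ¬ Wd.HasGoodReductionAt v → v ∈ s := fun v hv ↦
    Finset.mem_union_right _ (by rw [Set.Finite.mem_toFinset, mem_badPlaces_iff]; exact hv)
  rw [tamagawaProduct_eq_prod W s hsW, tamagawaProduct_eq_prod Wd s hsWd,
    padicValNat_finset_prod p s _ fun v _ ↦ ?_, padicValNat_finset_prod p s _ fun v _ ↦ ?_]
  · refine Finset.sum_congr rfl fun v _ ↦ ?_
    haveI := Fact.mk (primesEquiv v).2
    exact padicValNat_localTamagawaNumber_twist_eq W p hp5 K hK hH Cd hWd (primesEquiv v)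
  · haveI := Fact.mk (primesEquiv v).2
    haveI : (Wd.baseChange ℚ_[primesEquiv v]).IsElliptic :=
      inferInstanceAs (Wd.map (algebraMap ℚ ℚ_[primesEquiv v])).IsElliptic
    exact localTamagawaNumber_padic_ne_zero_holds (primesEquiv v) _
  · haveI := Fact.mk (primesEquiv v).2
    haveI : (W.baseChange ℚ_[primesEquiv v]).IsElliptic :=
      inferInstanceAs (W.map (algebraMap ℚ ℚ_[primesEquiv v])).IsElliptic
    exact localTamagawaNumber_padic_ne_zero_holds (primesEquiv v) _

end Summit.BirchSwinnertonDyer.Rank1Residual.X11b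

end
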